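import Summits.CriticalPhenomena.PercolationContinuityZ3.Theorems.Transplant.SkelPhiFaceOblN
import Summits.CriticalPhenomena.PercolationContinuityZ3.Theorems.Transplant.SkelPhiNegRealised
import HarnessLib

/-!
# N1 ({±1} node), (F) part 4b (hp-8 g33): the RUN form of the face residue with the window map chosen per face —
# **`Skelφ.faceOblRM_fineN : … → Skelφ.FaceOblRM G ⟨cellGeomSG₂ G (pr.ψ φ w₀) P w₀ (concRadii2N P gap gap' E₀ L' off), q, δc⟩ (faceDataSG …) Δ' δ₂`**
# (p282003's residue) at stmt-g13's N1 schedule `Skelφ.concRadii2N` (p283638; radii REALISED along runs), MODULO the kit clauses along runs —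
# twin of `SkelPhiConcFaceOblRun.faceOblR_concS` (hp-8 g30); per face the raw axis is `pr.bOf du.1` (argmax of `|lvGen du.1 ·|`) and the raw window
# is centred at a reference vertex over `faceCen` (`FinePrm.exists_vertex_ψ_eq`)

builds on p205010 (kernel theorem, internal audit signed; external expert review pending) — nothing in this file uses p205010; nothing here is a
claim about the open node `SamePDropOfSkeletonNeg`.
Lane `prim-bschramm`, seat `prim-hp-8` (gen 33); helper file (`--supports stmt-CriticalPhenomena-4575 --as helper`).
* §1 `FinePrm.bOf` (the raw axis of record) with `abs_lvGen_oth_bOf_le`, `lvGen_bOf_ne_zero`, `lvGen_ne_zero_of_detD_pos`, `cOf_pos`, `cOf_mul_L_le`;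
  `norm_add_stepVec_le`; the realised anchors / onward targets of `cellGeomSG₂` are p5-g8's `realised_of_choice_SG₂`, `tgt_add_stepVec_ne_zero₂`,
  `l1_tgt_le_nQ₂` (SkelPhiNegRealised, p286810), IMPORTED.
* §2 **`faceOblRM_fineN`** — binder groups: the skeleton map (`Lip`, `Steps`), the lattice record `pr` (`0 < c_i`, `D = det > 0`, `c_i L_i + 2 ≤ D`;
  the quasi-step floor `D ≤ 3·c_I·|A|·|lvGen I (bOf I)|` is the KIT layer's, not used here), the cells/schedule (`gap ≥ 1, 20 rmax, c`; `E₀ ≥ 2`, `L' ≥ 1`; the column slot `off` linear `≤ c‖x‖₁ + 1` and covering the fine column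
  points `‖rep₂(cen x)‖₁ + 1 ≤ off x`), the face-step rooms for both axes (`Rlev`, `k₀`, `kF`, `aw`), the count, `η ≤ δc/2`, an excess radius
  `R₁ ρ` for `φ` at entrance depth `ρ + 1` and planar diameter `m` with the diameter rooms, the gap floor `c + 2L' + R₁ ρ + 2 ≤ gap ρ`, and THE KIT
  CLAUSES ALONG RUNS (hypothesis `hkits`: for every run face and every reference vertex `yF` over its `faceCen`, the per-level clause of part 4 for
  `faceStepWN … (pr.bOf du.1) … pc …` with `pc = φ yF b − φ w₀ b`).
[cite: KozmaNitzan2024, §4 p. 27 ((30)), p. 30 (Step III), Lemma 10 (p. 17), Lemma 12 (p. 24)] [cite: MartineauSevero2019, Cor. 2.2]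
-/

noncomputable section

open MeasureTheory
open scoped Classical

namespace Summit.CriticalPhenomena.PercolationContinuityZ3.Theorems.Transplant

namespace Skelφ

open Literature.Probability.Percolation Literature.Probability.LatticeModels SimpleGraph KNCells KNLevels GadgetSystem Contour
open Literature.Probability.Percolation.KozmaNitzan
open Literature.Probability.Percolation.KozmaNitzan.Cells (oth oth_ne sgOf sgOf_sign stepVec_apply_fst stepVec_apply_oth eq_oth_of_ne oth_oth)
open Literature.Barriers.CriticalPhenomena (graphBall graphBall_finite mem_graphBall_self graphBall_mono)
open BoxProdZ2 (ConcRadiiG Erad Frad nQ nS Realised Frad_succ Frad_le_Erad)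
open Skel (winGraph WinStepData excess)
open TwoAxis.Para (detD modulus rep₂)

variable {V : Type} [DecidableEq V] {G : SimpleGraph V} [G.LocallyFinite] {φ : V → Site 2}

/-! ## §1 The raw axis of record; the norm of a macro-step -/

namespace FinePrm

variable (pr : FinePrm)

/-- **The raw axis of record** of a face crossed along cell axis `I`: the component of `lvGen I` of larger modulus. [this work] -/
def bOf (I : Fin 2) : Fin 2 := if |pr.lvGen I 1| ≤ |pr.lvGen I 0| then 0 else 1

/-- The other component is not larger: `|lvGen I (oth b)| ≤ |lvGen I b|` for `b = bOf I`. [folklore] -/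
theorem abs_lvGen_oth_bOf_le (I : Fin 2) : |pr.lvGen I (oth (pr.bOf I))| ≤ |pr.lvGen I (pr.bOf I)| := by
  unfold bOf
  split_ifs with h
  · rw [show oth (0 : Fin 2) = 1 from rfl]; exact h
  · rw [show oth (1 : Fin 2) = 0 from rfl]; exact (not_le.1 h).le

/-- The chosen component is nonzero as soon as the generator is. [folklore] -/
theorem lvGen_bOf_ne_zero (I : Fin 2) (h : pr.lvGen I ≠ 0) : pr.lvGen I (pr.bOf I) ≠ 0 := by
  intro h0
  have h1 := pr.abs_lvGen_oth_bOf_le I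
  rw [h0, abs_zero] at h1
  have h2 : pr.lvGen I (oth (pr.bOf I)) = 0 := abs_eq_zero.1 (le_antisymm h1 (abs_nonneg _))
  apply h
  funext k
  by_cases hk : k = pr.bOf I
  · rw [hk, h0]; rfl
  · rw [eq_oth_of_ne hk, h2]; rfl

/-- Both generators are nonzero when `D = A²·(n·vβ − h·vα) > 0`. [folklore] -/
theorem lvGen_ne_zero_of_detD_pos (hDd : pr.D = detD pr.A pr.n pr.h pr.vα pr.vβ) (hD : 0 < pr.D) (I : Fin 2) : pr.lvGen I ≠ 0 := by
  have hM := pr.A_mul_modulus_ne_zero hDd hD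
  intro h0
  apply hM
  obtain rfl | rfl : I = 0 ∨ I = 1 := by fin_cases I <;> simp
  · have h1 : pr.vα = 0 := by have := congrFun h0 0; simpa using this
    have h2 : pr.vβ = 0 := by have := congrFun h0 1; simpa using this
    unfold TwoAxis.Para.modulus; rw [h1, h2]; ring
  · have h1 : pr.n = 0 := by have := congrFun h0 0; simpa using this
    have h2 : pr.h = 0 := by have := congrFun h0 1; simpa using this
    unfold TwoAxis.Para.modulus; rw [h1, h2]; ring

/-- Both resolutions positive ⟹ `0 < cOf I`. [folklore] -/
theorem cOf_pos (hc₀ : 0 < pr.c₀) (hc₁ : 0 < pr.c₁) (I : Fin 2) : 0 < pr.cOf I := by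
  obtain rfl | rfl : I = 0 ∨ I = 1 := by fin_cases I <;> simp
  · rwa [cOf_zero]
  · rwa [cOf_one]

/-- Both resolution rooms ⟹ `cOf I · L I ≤ D`. [folklore] -/
theorem cOf_mul_L_le (hL0 : pr.c₀ * pr.L 0 ≤ pr.D) (hL1 : pr.c₁ * pr.L 1 ≤ pr.D) (I : Fin 2) : pr.cOf I * pr.L I ≤ pr.D := by
  obtain rfl | rfl : I = 0 ∨ I = 1 := by fin_cases I <;> simp
  · rwa [cOf_zero]
  · rwa [cOf_one]

end FinePrm


/-- `‖x + du‖₁ ≤ ‖x‖₁ + 1` for a macro-step `du`. [folklore] -/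
theorem norm_add_stepVec_le (x : Site 2) (du : MDir) :
    ((x + stepVec du) 0).natAbs + ((x + stepVec du) 1).natAbs ≤ (x 0).natAbs + (x 1).natAbs + 1 := by
  have ha : stepVec du du.1 = sgOf du := stepVec_apply_fst du
  have hb : stepVec du (oth du.1) = 0 := stepVec_apply_oth du
  have hs : (sgOf du).natAbs = 1 := by rcases sgOf_sign du with hσ | hσ <;> simp [hσ]
  have key : ∀ i, ((x + stepVec du) i).natAbs ≤ (x i).natAbs + (stepVec du i).natAbs := fun i => by
    simp only [Pi.add_apply]; exact Int.natAbs_add_le _ _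
  have hsum : (stepVec du 0).natAbs + (stepVec du 1).natAbs = 1 := by
    have hd : du.1 = 0 ∨ du.1 = 1 := by rcases du with ⟨i, b⟩; fin_cases i <;> simp
    rcases hd with hd | hd
    · have ho : oth du.1 = 1 := by rw [hd]; rfl
      rw [hd] at ha; rw [ho] at hb; simp [ha, hb, hs]
    · have ho : oth du.1 = 0 := by rw [hd]; rfl
      rw [hd] at ha; rw [ho] at hb; simp [ha, hb, hs]
  have h0 := key 0
  have h1 := key 1
  omega

/-! ## §2 The run form of the face residue, window map per face -/

section Run

variable [Countable V] (pr : FinePrm) (φ) (P : PCells2) (w₀ : V) (gap gap' : ℕ → ℕ) (E₀ L' : ℕ) (off : Site 2 → ℕ) (q : unitInterval) (δc : ℝ)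

/-- **`FaceOblRM` for the fine-cell scheme of record at the N1 schedule, modulo the kit clauses along runs** (from `Lip`, `Steps` of the skeleton
map).  Along RUN histories the anchors of the chosen edge are realised, so with `g := nQ (aOf₁) x`: `rM_{a'}(x+du) = E g + gap (E g) − L'`,
`ρ ≤ E g − 2`, `rQ_{aOf₁}(x) = E g`; entrance depth `E g + 1`, excess radius `R₁ (E g)`; the target `M_{a'}(x+du)` holds the vertex over `cen (x+du)`
(`‖rep₂(cen(x+du))‖₁ + 1 ≤ off (x+du) ≤ c(‖x‖₁+1) + 1 ≤ rM`); per face the window map is the frame `pr.frame φ w₀ du.1 (pr.bOf du.1)` about a reference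
vertex over `faceCen`. [cite: KozmaNitzan2024, §4 p. 30 (Step III), Lemma 10 (p. 17), Lemma 12 (p. 24)] [cite: MartineauSevero2019, Cor. 2.2] -/
theorem faceOblRM_fineN (hlip : Lip G φ) (hstep : Steps G φ) (hc₀ : 0 < pr.c₀) (hc₁ : 0 < pr.c₁)
    (hDd : pr.D = detD pr.A pr.n pr.h pr.vα pr.vβ) (hD : 0 < pr.D) (hL0 : pr.c₀ * pr.L 0 + 2 ≤ pr.D) (hL1 : pr.c₁ * pr.L 1 + 2 ≤ pr.D)
    (hgap : ∀ n, 1 ≤ gap n) (hgap20 : ∀ n, 20 * P.rmax ≤ gap n) {c : ℕ} (hgapc : ∀ n, c ≤ gap n) (hE₀ : 2 ≤ E₀) (hL' : 1 ≤ L')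
    (hoff : ∀ x : Site 2, off x ≤ c * ((x 0).natAbs + (x 1).natAbs) + 1)
    (hoffN : ∀ x : Site 2, (rep₂ pr.A pr.n pr.h pr.vα pr.vβ pr.c₀ pr.c₁ (P.cen x) 0).natAbs +
      (rep₂ pr.A pr.n pr.h pr.vα pr.vβ pr.c₀ pr.c₁ (P.cen x) 1).natAbs + 1 ≤ off x)
    {Δ' Rlev N M : ℕ} {δ₂ : ℝ} (hRlev : ∀ i, Rlev + 4 ≤ 10 * P.s i) (hRlev' : ∀ i, Rlev + 4 ≤ 3 * P.r i)
    {aw : ℕ} {k₀ kF : ℤ} (hk₀ : ∀ I, pr.rdN I (pr.bOf I) ≤ pr.rdK I (pr.bOf I) * k₀)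
    (hk₀' : ∀ i, 3 * (P.r i : ℤ) + k₀ + 3 ≤ 5 * P.r i)
    (hroomF : ∀ I, pr.Mabs * (aw + Rlev + 1) + pr.rdN I (pr.bOf I) * (Rlev + 2) * pr.D ≤ pr.rdK I (pr.bOf I) * kF * pr.D)
    (hkF : ∀ i, kF + 3 ≤ 5 * (P.r i : ℤ))
    (haw : ∀ du : MDir, (pr.rdK 1 (pr.bOf du.1) * (P.faceExt du 0 + 1) + pr.rdK 0 (pr.bOf du.1) * (P.faceExt du 1 + 1)) * pr.D ≤
      pr.Mabs * (aw + 1))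
    (hcount : 1 / (1 - (q : ℝ)) ^ (Δ' * N) ≤ δ₂ * ((Finset.Icc (M + 1) Rlev).card : ℝ))
    {η : ℝ} (hη : η ≤ δc / 2) (R₁ : ℕ → ℕ) {m : ℕ}
    (hR₁ : ∀ ρ R', R₁ ρ ≤ R' → ∀ (Rw : ℕ) (D' A' : Finset V), (∀ d ∈ D', d ∈ graphBall G w₀ Rw) →
      (∀ d ∈ D', ∀ d' ∈ D', φ d - φ d' ∈ box 2 m) → A' ⊆ D' → (∀ a ∈ A', a ∈ graphBall G w₀ (ρ + 1)) →
        (bondPercolation G q).real (excess G w₀ R' D' A') ≤ η)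
    (hdiam : ∀ b' : Fin 2, (pr.rdK 1 b' + pr.rdK 0 b') * ((50 * P.rmax : ℕ) + 1) * pr.D ≤ pr.Mabs * (m + 1))
    (hgapR : ∀ ρ, c + 2 * L' + R₁ ρ + 2 ≤ gap ρ)
    (hkits : ∀ (h : ProbeHistory V) (e : Site 2 × MDir),
      let Λ := concRadii2N P gap gap' E₀ L' off
      let S : KSchA V ℕ := ⟨cellGeomSG₂ G (pr.ψ φ w₀) P w₀ Λ, q, δc⟩
      S.IsRun₂ G h → (S.astOf₂ G h).st.choice = some e → S.Valid₂ G h e →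
      ∀ du ∈ S.onward G h (tgt e), ∀ j < P.K, ∀ o : Finset (Sym2 V), ∀ (yF : V) (pc : ℤ),
      pr.ψ φ w₀ yF = P.faceCen (tgt e) du j → pc = relφ φ w₀ yF (pr.bOf du.1) →
      let a := S.aOf₁ G h e
      let a' := S.aOf₂ G h e
      let Q := faceStepWN G pr φ P w₀ Λ (pr.bOf du.1) a' (tgt e) du j pc aw Rlev N M L' (S.Sx G h e a a' du)
      ∀ j' ∈ Finset.Icc Q.j₀ Q.j₁, ∃ (σ : KNLevels.SData V) (Sz : Finset V),
        KNLevels.SHyp (winLData G (pr.frame φ w₀ du.1 (pr.bOf du.1)) Q.root Q.Rπ Q.lo Q.hi Q.root Q.Sfin) j' σ ∧ σ.N ≤ Q.N ∧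
        (1 - (S.p : ℝ) ^ σ.sB) ^ σ.k ≤ δ₂ ∧
        Sz ⊆ (winLData G (pr.frame φ w₀ du.1 (pr.bOf du.1)) Q.root Q.Rπ Q.lo Q.hi Q.root Q.Sfin).X j' ∧
        Sz ⊆ stepRg G (pr.frame φ w₀ du.1 (pr.bOf du.1)) Q ∧
        (∀ x ∈ σ.K, ∀ e' ∈ σ.seed x, e' ∉ wireSet (↑Sz : Set V)) ∧ (∀ x ∈ σ.K, σ.face x ⊆ Sz) ∧
        (∀ x ∈ σ.K, 1 - 3 * δ₂ ≤ (prodBernoulli (S.Wt G h e a a' du j o)).real {ω | ∃ u ∈ σ.face x,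
          1 - δ₂ < (prodBernoulli (pinW (S.Wt G h e a a' du j o) (wireSet (↑Sz : Set V)) ω)).real
            (⋃ t ∈ Q.T, openConnIn (↑(stepRg G (pr.frame φ w₀ du.1 (pr.bOf du.1)) Q) : Set V) u t)})) :
    FaceOblRM G (⟨cellGeomSG₂ G (pr.ψ φ w₀) P w₀ (concRadii2N P gap gap' E₀ L' off), q, δc⟩ : KSchA V ℕ)
      (faceDataSG G (pr.ψ φ w₀) P w₀ (concRadii2N P gap gap' E₀ L' off)) Δ' δ₂ := by
  intro h e hrun hch hV du hdu j hj o
  set Λ := concRadii2N P gap gap' E₀ L' off with hΛdef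
  set S : KSchA V ℕ := ⟨cellGeomSG₂ G (pr.ψ φ w₀) P w₀ Λ, q, δc⟩ with hS
  -- the two maps
  have hL0' : pr.c₀ * pr.L 0 ≤ pr.D := by omega
  have hL1' : pr.c₁ * pr.L 1 ≤ pr.D := by omega
  have hlipψ : Lip G (pr.ψ φ w₀) := pr.lip_ψ hlip w₀ hc₀.le hc₁.le hD hL0' hL1'
  have hws : WeakSteps G (pr.ψ φ w₀) := pr.weakSteps_ψ hstep w₀ hc₀.le hc₁.le hD
  have hψ0 : pr.ψ φ w₀ w₀ = 0 := pr.ψ_base φ w₀ hD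
  have hcI : 0 < pr.cOf du.1 := pr.cOf_pos hc₀ hc₁ du.1
  have hLI : pr.cOf du.1 * pr.L du.1 ≤ pr.D := pr.cOf_mul_L_le hL0' hL1' du.1
  have hM := pr.A_mul_modulus_ne_zero hDd hD
  have hnz : pr.lvGen du.1 (pr.bOf du.1) ≠ 0 := pr.lvGen_bOf_ne_zero du.1 (pr.lvGen_ne_zero_of_detD_pos hDd hD du.1)
  have hlipF : Lip G (pr.frame φ w₀ du.1 (pr.bOf du.1)) := pr.lip_frame hlip w₀ du.1 (pr.bOf du.1) hcI.le hD hLI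
  -- the schedule and the realised radii
  have hΛ : WFS2 P Λ := concRadii2N_WFS2 P gap gap' E₀ L' off hgap hE₀ hL'
  have hr : Realised (S.aOf₁ G h e) (S.aOf₂ G h e) (tgt e) := realised_of_choice_SG₂ h hch
  have hy : tgt e + stepVec du ≠ 0 := tgt_add_stepVec_ne_zero₂ hψ0 hV hdu
  have hE₀' : 1 ≤ E₀ := by omega
  have hxn : (tgt e 0).natAbs + (tgt e 1).natAbs ≤ nQ (S.aOf₁ G h e) (tgt e) := l1_tgt_le_nQ₂ h hch
  set g := nQ (S.aOf₁ G h e) (tgt e) with hg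
  have hrM : Λ.rM (S.aOf₂ G h e) (tgt e + stepVec du) = Erad gap gap' E₀ g + gap (Erad gap gap' E₀ g) - L' := by
    change Frad gap gap' E₀ (nQ (S.aOf₂ G h e) (tgt e + stepVec du)) - L' = _
    rw [hr.nQ_add_stepVec hy, Frad_succ]
  have hρ : ∀ ℓ, Λ.ρ (S.aOf₂ G h e) (tgt e) du ℓ ≤ Erad gap gap' E₀ g := fun ℓ =>
    (concRadii2N_ρ_le P gap gap' E₀ L' off _ _ _ ℓ).trans (by rw [hr.nS_eq]; exact Nat.sub_le _ _)
  have hQ : Λ.rQ (S.aOf₁ G h e) (tgt e) ≤ Erad gap gap' E₀ g :=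
    (concRadii2N_rQ_eq_of_norm_le P gap' E₀ L' off hgap20 hgapc hE₀' hxn (hoff _)).le
  have hgapg := hgapR (Erad gap gap' E₀ g)
  have hElin := Erad_linear gap' E₀ hgapc g
  -- the true target holds the vertex over `cen (x + du)`
  have hMne : (S.Γ.M (S.aOf₂ G h e) (tgt e + stepVec du)).Nonempty := by
    obtain ⟨y, hyb, hyc⟩ := pr.exists_vertex_ψ_eq hstep w₀ hc₀ hc₁ hDd hD hL0 hL1 (P.cen (tgt e + stepVec du)) le_rfl
    refine M_nonempty_of_vertex hlipψ hws hyb hyc ?_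
    have h1 := hoffN (tgt e + stepVec du)
    have h2 := hoff (tgt e + stepVec du)
    have h3 := norm_add_stepVec_le (tgt e) du
    have h4 : c * (((tgt e + stepVec du) 0).natAbs + ((tgt e + stepVec du) 1).natAbs) ≤ c * (g + 1) := Nat.mul_le_mul_left _ (by omega)
    change _ ≤ Λ.rM (S.aOf₂ G h e) (tgt e + stepVec du)
    rw [hrM]
    have : c * (g + 1) = c * g + c := by ring
    omega
  -- the reference vertex over the face centre
  obtain ⟨yF, -, hyF⟩ := pr.exists_vertex_ψ_eq hstep w₀ hc₀ hc₁ hDd hD hL0 hL1 (P.faceCen (tgt e) du j) le_rfl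
  have hRlev₁ : Rlev + 4 ≤ 10 * P.s du.1 := hRlev du.1
  have hRlev₂ : Rlev + 4 ≤ 3 * P.r (oth du.1) := hRlev' (oth du.1)
  refine faceOblAtM_fineN (S := S) rfl hΛ hV hdu hlipψ hws hlipF hc₀ hc₁ hD hM hnz (show j + 1 ≤ P.K from hj) hyF rfl hRlev₁ hRlev₂
    (hk₀ du.1) (hk₀' (oth du.1)) (hroomF du.1) (hkF (oth du.1)) (haw du) hcount hMne
    (fun j' hj' => hkits h e hrun hch hV du hdu j hj o yF _ hyF rfl j' hj') hQ hρ hη (hR₁ (Erad gap gap' E₀ g)) ?_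
    (hdiam_fine (S := S) rfl hM hc₀ hc₁ hD hdiam (tgt e))
  rw [hrM]; omega

end Run

end Skelφ

end Summit.CriticalPhenomena.PercolationContinuityZ3.Theorems.Transplant

end
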